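import Literature.NumberTheory.ModularForms.DedekindSumReciprocity
import Mathlib.Data.ZMod.Basic
import HarnessLib

/-!
# Rademacher's `Φ` on the Bézout matrices of a cusp `b/d` of `Γ₀(N)`: the explicit Dedekind-sum formula

Topic `Literature/NumberTheory/ModularForms`; namespace `Literature.NumberTheory.ModularForms`.
Theorem-only sequel of `DedekindSumRademacherPhi` / `DedekindSumReciprocity` (defs `dedekindSaw`,
`dedekindSum`, `rademacherPhi`; `dedekindSum_reciprocity` proved there). No definitions, no named facts.

* `dedekindSaw_div_congr` — `((m/k)) = ((n/k))` for `m ≡ n (mod k)`;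
  **`dedekindSum_eq_of_mul_emod_eq_one`** — `s(h̄, k) = s(h, k)` for `h h̄ ≡ 1 (mod k)`
  [cite: Apostol1990, Thm. 3.6(b) (PDF p. 64)] [cite: RademacherGrosswald1972, Ch. 3 A, eq. (33b)].
* **`rademacherPhi_bezout_conj`** — for `N ≥ 1`, `t ∣ N`, `d ≥ 2` and `b ∈ ℤ` with `gcd(d, bN) = 1`, let
  `x = gcdA(d, bN)`, `y = gcdB(d, bN)` (so `dx + bNy = 1` and `γ_{b,d} = (x, b; −Ny, d) ∈ Γ₀(N)` is the
  Bézout matrix with `γ_{b,d}·0 = b/d`); then Rademacher's `Φ` [cite: RademacherGrosswald1972, Ch. 4 A,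
  eq. (59)] at the level-`t` conjugate `(x, tb; −Ny/t, d)` is
  **`Φ(x, tb; −Ny/t, d) = −12·s(tb, d) + Ny/(td) + tb/d − 3·sign(y)`** — eq. (59), the reciprocity law
  [cite: Apostol1990, Thm. 3.7] for the coprime pair `(d, N|y|/t)`, and `s(N|y|/t, d) = sign(y)·s(tb, d)`
  (`(tb)·(Ny/t) = 1 − dx ≡ 1 (mod d)`, Thm. 3.6(b)).  (Stevens' formula `ξ_E(α) = (a/c)a₀(E) +
  (d/c)a₀(E|α) − s_E(a/c)` [cite: Stevens1982, §2.5 eq. (2.5.3) (PDF p. 38)] is the conceptual form: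
  the period along `α` is a Dedekind symbol of the cusp plus constant-term contributions.)
* **`sum_rademacherPhi_bezout_conj`** — for coefficients `c : ℕ → ℚ` on a finite set `T` of divisors
  of `N` with `∑_t c_t = 0` and `∑_t c_t·t = 0` (the cusp conditions of a holomorphic combination
  `∑_t c_t E₂(tz)`): `∑_{t∈T} c_t Φ(x, tb; −Ny/t, d) = −12 ∑_{t∈T} c_t s(tb, d) + (∑_{t∈T} c_t/t)·Ny/d` —
  the value of the period function of the stabilised weight-2 Eisenstein series on `γ_{b,d}`: a
  Dedekind-sum distribution in the cusp `b/d` plus the term `(∑ c_t/t)·Ny/d`, `Ny ≡ b⁻¹ (mod d)`.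

Written for the BSD cell's crux `stmt-BirchSwinnertonDyer-20341` (line `star`, stub (★-EisNorm): the
Summit-side `stabEisensteinPeriod N β` evaluated on `gammaEntries N a 2^m` is `sum_rademacherPhi_bezout_conj`
with `T = N.divisors`, `c = stabCoeff N β`, once the local copies of `saw`/`dedekindSum`/`rademacherPhi`
there are identified with the present ones).

## References

* [Apostol1990] T. M. Apostol, *Modular Functions and Dirichlet Series in Number Theory*, 2nd ed.,
  GTM 41 (1990), §3.7 Thm. 3.6, §3.8 Thm. 3.7 (PDF p. 64). Held text
  `book:apostol1990-modular-functions-dirichlet-series-number-theory`.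
* [RademacherGrosswald1972] H. Rademacher, E. Grosswald, *Dedekind Sums*, Carus Math. Monographs 16
  (1972), Ch. 3 A eq. (33a)–(33b), Ch. 4 A eq. (59).
* [Stevens1982] G. Stevens, *Arithmetic on Modular Curves*, Progress in Math. 20 (1982), §2.5
  (Def. 2.5.2, eq. (2.5.3), Prop. 2.5.4; PDF pp. 37–39). Held text `book:stevensnd-arithmetic-modular-curves`.
-/

namespace Literature.NumberTheory.ModularForms

open Finset

/-! ### `s(h̄, k) = s(h, k)` -/

/-- `((m/k)) = ((n/k))` for `m ≡ n (mod k)` (period `1` of the sawtooth). [cite: Apostol1990, Thm. 3.6(a) (PDF p. 64)] -/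
theorem dedekindSaw_div_congr {k : ℕ} {m n : ℤ} (h : m % k = n % k) :
    dedekindSaw ((m : ℚ) / k) = dedekindSaw ((n : ℚ) / k) := by
  rcases Nat.eq_zero_or_pos k with rfl | hk
  · simp
  · have hk' : (k : ℚ) ≠ 0 := by exact_mod_cast hk.ne'
    obtain ⟨q, hq⟩ : (k : ℤ) ∣ n - m := Int.ModEq.dvd h
    have hm : (m : ℚ) / k = (n : ℚ) / k + ((-q : ℤ) : ℚ) := by
      have : (m : ℚ) = n - k * q := by
        have e : m = n - k * q := by linarith [hq]
        rw [e]; push_cast; ring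
      rw [this]; push_cast; field_simp; ring
    rw [hm, dedekindSaw_add_intCast]

/-- Summing `G(b.val)` over `ℤ/M` is summing `G` over `0 ≤ μ < M`. [folklore] -/
private theorem sum_univ_val_eq_sum_range' {M : ℕ} [NeZero M] {R : Type*} [AddCommMonoid R]
    (G : ℕ → R) : ∑ b : ZMod M, G b.val = ∑ μ ∈ Finset.range M, G μ := by
  refine Finset.sum_nbij' (fun b ↦ b.val) (fun μ ↦ (μ : ZMod M)) (fun b _ ↦ ?_) (fun μ _ ↦ ?_)
    (fun b _ ↦ ?_) (fun μ hμ ↦ ?_) (fun b _ ↦ rfl)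
  · exact Finset.mem_range.mpr (ZMod.val_lt b)
  · exact Finset.mem_univ _
  · exact ZMod.natCast_zmod_val b
  · exact ZMod.val_natCast_of_lt (Finset.mem_range.mp hμ)

/-- **`s(h̄, k) = s(h, k)` when `h h̄ ≡ 1 (mod k)`** ("If `hh̄ ≡ ±1 (mod k)` then `s(h̄, k) = ±s(h, k)`",
the `+` case; substitute `μ ↦ hμ` in the sum). [cite: Apostol1990, Thm. 3.6(b) (PDF p. 64)]
[cite: RademacherGrosswald1972, Ch. 3 A, eq. (33b)] -/
theorem dedekindSum_eq_of_mul_emod_eq_one {k : ℕ} {h h' : ℤ} (hinv : (k : ℤ) ∣ h * h' - 1) :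
    dedekindSum h' k = dedekindSum h k := by
  rcases Nat.eq_zero_or_pos k with rfl | hk
  · simp
  haveI : NeZero k := ⟨hk.ne'⟩
  have hu1 : (h : ZMod k) * (h' : ZMod k) = 1 := by
    have h0 : ((h * h' - 1 : ℤ) : ZMod k) = 0 := (ZMod.intCast_zmod_eq_zero_iff_dvd _ _).mpr hinv
    push_cast at h0
    exact sub_eq_zero.mp h0
  have hu : IsUnit (h : ZMod k) := IsUnit.of_mul_eq_one _ hu1
  rw [dedekindSum, dedekindSum,
    ← sum_univ_val_eq_sum_range' (M := k)
      (fun μ ↦ dedekindSaw ((μ : ℚ) / k) * dedekindSaw ((h' : ℚ) * μ / k)),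
    ← sum_univ_val_eq_sum_range' (M := k)
      (fun μ ↦ dedekindSaw ((μ : ℚ) / k) * dedekindSaw ((h : ℚ) * μ / k))]
  symm
  refine Fintype.sum_equiv hu.unit.mulLeft _ _ fun b ↦ ?_
  -- the summand at `b` on the right is the summand at `u b` on the left
  have hub : (hu.unit.mulLeft b : ZMod k) = (h : ZMod k) * b := by
    rw [Units.mulLeft_apply, IsUnit.unit_spec]
  set v : ℕ := ((h : ZMod k) * b).val with hv
  have F1 : (v : ℤ) % k = (h * b.val) % k := by
    rw [← ZMod.intCast_eq_intCast_iff']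
    push_cast
    rw [hv, ZMod.natCast_zmod_val, ZMod.natCast_zmod_val]
  have F2 : (h' * v : ℤ) % k = (b.val : ℤ) % k := by
    rw [← ZMod.intCast_eq_intCast_iff']
    push_cast
    rw [hv, ZMod.natCast_zmod_val, ZMod.natCast_zmod_val, ← mul_assoc, mul_comm (h' : ZMod k), hu1,
      one_mul]
  have e1 : dedekindSaw ((v : ℚ) / k) = dedekindSaw ((h : ℚ) * b.val / k) := by
    have := dedekindSaw_div_congr F1
    push_cast at this
    exact this
  have e2 : dedekindSaw ((h' : ℚ) * v / k) = dedekindSaw ((b.val : ℚ) / k) := by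
    have := dedekindSaw_div_congr F2
    push_cast at this
    exact this
  simp only [hub]
  rw [← hv, e1, e2, mul_comm]

/-! ### `Φ` on the Bézout matrix of the cusp `b/d` and its level-`t` conjugates -/

/-- **Rademacher's `Φ` at the level-`t` conjugate of the Bézout matrix of the cusp `b/d`**: for
`N ≥ 1`, `t ∣ N`, `d ≥ 2`, `gcd(d, bN) = 1`, `x = gcdA(d,bN)`, `y = gcdB(d,bN)` (`dx + bNy = 1`):
`Φ(x, tb; −Ny/t, d) = −12·s(tb, d) + Ny/(td) + tb/d − 3·sign(y)`.
[cite: RademacherGrosswald1972, Ch. 4 A, eq. (59)] [cite: Apostol1990, Thm. 3.7 and Thm. 3.6(b) (PDF p. 64)]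
[cite: Stevens1982, §2.5 eq. (2.5.3) (PDF p. 38)] -/
theorem rademacherPhi_bezout_conj {N t d : ℕ} {b : ℤ} (hN : 0 < N) (ht : t ∣ N) (hd : 1 < d)
    (hcop : Int.gcd (d : ℤ) (b * N) = 1) :
    rademacherPhi (Int.gcdA (d : ℤ) (b * N)) (t * b) ((-(N : ℤ) * Int.gcdB (d : ℤ) (b * N)) / t) d =
      -12 * dedekindSum (t * b) d + (N : ℚ) * Int.gcdB (d : ℤ) (b * N) / ((t : ℚ) * d) +
        (t : ℚ) * b / d - 3 * (Int.sign (Int.gcdB (d : ℤ) (b * N)) : ℚ) := by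
  set x := Int.gcdA (d : ℤ) (b * N) with hx
  set y := Int.gcdB (d : ℤ) (b * N) with hy
  have hbez : (d : ℤ) * x + b * N * y = 1 := by
    have e := Int.gcd_eq_gcd_ab (d : ℤ) (b * N)
    rw [hcop] at e
    push_cast at e
    linear_combination -e
  have ht0 : 0 < t := Nat.pos_of_dvd_of_pos ht hN
  obtain ⟨n', hn'⟩ := ht
  have hn'0 : 0 < n' := Nat.pos_of_ne_zero fun h0 ↦ by simp [h0] at hn'; omega
  have hbez' : (d : ℤ) * x + b * t * n' * y = 1 := by
    rw [hn'] at hbez; push_cast at hbez; linear_combination hbez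
  have hy0 : y ≠ 0 := by
    intro h0
    rw [h0, mul_zero, add_zero] at hbez'
    have h1 : (d : ℤ) ∣ 1 := ⟨x, hbez'.symm⟩
    have h2 : (d : ℤ) ≤ 1 := Int.le_of_dvd one_pos h1
    omega
  -- the lower-left entry `−Ny/t = −n'y`
  have hc : (-(N : ℤ) * y) / t = -(n' : ℤ) * y := by
    rw [hn']
    push_cast
    rw [show -((t : ℤ) * n') * y = (-(n' : ℤ) * y) * t by ring,
      Int.mul_ediv_cancel _ (by exact_mod_cast ht0.ne')]
  have hc0 : -(n' : ℤ) * y ≠ 0 := mul_ne_zero (neg_ne_zero.mpr (by exact_mod_cast hn'0.ne')) hy0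
  rw [hc, rademacherPhi_of_c_ne_zero hc0]
  -- `|c| = n'|y|`, `sign c = −sign y`
  have hnat : (-(n' : ℤ) * y).natAbs = n' * y.natAbs := by
    rw [Int.natAbs_mul, Int.natAbs_neg, Int.natAbs_natCast]
  have hsign : Int.sign (-(n' : ℤ) * y) = -Int.sign y := by
    rw [neg_mul, Int.sign_neg, Int.sign_mul, Int.sign_natCast_of_ne_zero hn'0.ne', one_mul]
  rw [hnat, hsign]
  -- coprimality of `d` and `n'|y|`, the reciprocity law, and `s(n'y, d) = s(tb, d)`
  have hcopr : Nat.Coprime d (n' * y.natAbs) := by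
    have h1 : IsCoprime (d : ℤ) ((n' : ℤ) * y) := ⟨x, b * t, by linear_combination hbez'⟩
    have h2 := Int.isCoprime_iff_gcd_eq_one.mp h1
    rw [Int.gcd_eq_natAbs, Int.natAbs_natCast, Int.natAbs_mul, Int.natAbs_natCast] at h2
    exact h2
  have hc'0 : 0 < n' * y.natAbs := Nat.mul_pos hn'0 (Int.natAbs_pos.mpr hy0)
  have hrec := dedekindSum_reciprocity (by omega : 0 < d) hc'0 hcopr
  have hinv : dedekindSum ((n' : ℤ) * y) d = dedekindSum ((t : ℤ) * b) d :=
    dedekindSum_eq_of_mul_emod_eq_one ⟨-x, by linear_combination hbez'⟩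
  -- the sign `σ = ±1` of `y`: `|y| = σ y`, `s(n'|y|, d) = σ s(tb, d)`
  obtain ⟨σ, hσy, hσ1, habs, hsd⟩ : ∃ σ : ℤ, Int.sign y = σ ∧ (σ = 1 ∨ σ = -1) ∧
      ((y.natAbs : ℕ) : ℤ) = σ * y ∧
      dedekindSum ((n' * y.natAbs : ℕ) : ℤ) d = σ * dedekindSum ((t : ℤ) * b) d := by
    rcases lt_or_gt_of_ne hy0 with hneg | hpos
    · refine ⟨-1, Int.sign_eq_neg_one_of_neg hneg, Or.inr rfl, ?_, ?_⟩
      · rw [Int.ofNat_natAbs_of_nonpos hneg.le]; ring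
      · rw [← hinv, Nat.cast_mul, Int.ofNat_natAbs_of_nonpos hneg.le, mul_neg, dedekindSum_neg]
        push_cast; ring
    · refine ⟨1, Int.sign_eq_one_of_pos hpos, Or.inl rfl, ?_, ?_⟩
      · rw [Int.natAbs_of_nonneg hpos.le]; ring
      · rw [← hinv, Nat.cast_mul, Int.natAbs_of_nonneg hpos.le]
        push_cast; ring
  rw [hsd] at hrec
  -- now pure algebra over `ℚ`
  have hd0 : (d : ℚ) ≠ 0 := by exact_mod_cast (by omega : d ≠ 0)
  have hn'q : (n' : ℚ) ≠ 0 := by exact_mod_cast hn'0.ne'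
  have hyq : (y : ℚ) ≠ 0 := by exact_mod_cast hy0
  have htq : (t : ℚ) ≠ 0 := by exact_mod_cast ht0.ne'
  have hσq : (σ : ℚ) ≠ 0 := by rcases hσ1 with h | h <;> simp [h]
  have habsq : ((y.natAbs : ℕ) : ℚ) = σ * y := by
    have e := congrArg (Int.cast : ℤ → ℚ) habs
    rw [Int.cast_natCast, Int.cast_mul] at e
    exact e
  have hbezq : (d : ℚ) * x + b * t * n' * y = 1 := by exact_mod_cast hbez'
  push_cast at hrec ⊢
  rw [habsq] at hrec
  rw [hσy, hn']
  push_cast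
  -- eliminate `s(d, n'|y|)` via the reciprocity law and `x` via Bézout
  have hP : dedekindSum (d : ℤ) (n' * y.natAbs) =
      ((d : ℚ) ^ 2 + ((n' : ℚ) * (σ * y)) ^ 2 - 3 * d * (n' * (σ * y)) + 1 -
        12 * (n' * (σ * y)) * d * (σ * dedekindSum ((t : ℤ) * b) d)) / (12 * d * (n' * (σ * y))) := by
    field_simp
    linear_combination hrec
  have hxq : (x : ℚ) = (1 - b * t * n' * y) / d := by
    field_simp
    linear_combination hbezq
  rw [hP, hxq]
  rcases hσ1 with h1 | h1
  · subst h1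
    push_cast
    field_simp
    ring
  · subst h1
    push_cast
    field_simp
    ring

/-- The case `t = 1`: **`Φ(γ_{b,d}) = −12·s(b, d) + Ny/d + b/d − 3·sign(y)`** for the Bézout matrix
`γ_{b,d} = (x, b; −Ny, d)` of the cusp `b/d` of `Γ₀(N)`.
[cite: RademacherGrosswald1972, Ch. 4 A, eq. (59)] [cite: Apostol1990, Thm. 3.7 (PDF p. 64)] -/
theorem rademacherPhi_bezout {N d : ℕ} {b : ℤ} (hN : 0 < N) (hd : 1 < d)
    (hcop : Int.gcd (d : ℤ) (b * N) = 1) :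
    rademacherPhi (Int.gcdA (d : ℤ) (b * N)) b (-(N : ℤ) * Int.gcdB (d : ℤ) (b * N)) d =
      -12 * dedekindSum b d + (N : ℚ) * Int.gcdB (d : ℤ) (b * N) / d +
        (b : ℚ) / d - 3 * (Int.sign (Int.gcdB (d : ℤ) (b * N)) : ℚ) := by
  have h := rademacherPhi_bezout_conj (t := 1) hN (one_dvd N) hd hcop
  simp only [Nat.cast_one, one_mul, Int.ediv_one] at h
  rw [h]

/-- **The period function of a stabilised weight-2 Eisenstein series on the Bézout matrix of the
cusp `b/d`**: for coefficients `c_t` (`t ∈ T`, divisors of `N`) with `∑ c_t = 0` and `∑ c_t·t = 0`,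
`∑_{t∈T} c_t·Φ(x, tb; −Ny/t, d) = −12·∑_{t∈T} c_t·s(tb, d) + (∑_{t∈T} c_t/t)·Ny/d`.
[cite: RademacherGrosswald1972, Ch. 4 A, eq. (59)] [cite: Stevens1982, §2.5 eq. (2.5.3) (PDF p. 38)] -/
theorem sum_rademacherPhi_bezout_conj {N d : ℕ} {b : ℤ} (hN : 0 < N) (hd : 1 < d)
    (hcop : Int.gcd (d : ℤ) (b * N) = 1) (T : Finset ℕ) (hT : ∀ t ∈ T, t ∣ N) (c : ℕ → ℚ)
    (hc0 : ∑ t ∈ T, c t = 0) (hc1 : ∑ t ∈ T, c t * t = 0) :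
    ∑ t ∈ T, c t *
        rademacherPhi (Int.gcdA (d : ℤ) (b * N)) (t * b) ((-(N : ℤ) * Int.gcdB (d : ℤ) (b * N)) / t) d =
      -12 * ∑ t ∈ T, c t * dedekindSum (t * b) d +
        (∑ t ∈ T, c t / t) * ((N : ℚ) * Int.gcdB (d : ℤ) (b * N) / d) := by
  have hd0 : (d : ℚ) ≠ 0 := by exact_mod_cast (by omega : d ≠ 0)
  have step : ∀ t ∈ T, c t *
      rademacherPhi (Int.gcdA (d : ℤ) (b * N)) (t * b) ((-(N : ℤ) * Int.gcdB (d : ℤ) (b * N)) / t) d =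
      -12 * (c t * dedekindSum (t * b) d) +
        c t / t * ((N : ℚ) * Int.gcdB (d : ℤ) (b * N) / d) +
        (b : ℚ) / d * (c t * t) - 3 * (Int.sign (Int.gcdB (d : ℤ) (b * N)) : ℚ) * c t := by
    intro t ht
    have ht0 : (t : ℚ) ≠ 0 := by exact_mod_cast (Nat.pos_of_dvd_of_pos (hT t ht) hN).ne'
    rw [rademacherPhi_bezout_conj hN (hT t ht) hd hcop]
    field_simp
  rw [Finset.sum_congr rfl step, Finset.sum_sub_distrib, Finset.sum_add_distrib, Finset.sum_add_distrib,
    ← Finset.mul_sum, ← Finset.sum_mul, ← Finset.mul_sum, ← Finset.mul_sum, hc1, hc0]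
  ring

end Literature.NumberTheory.ModularForms
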